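/-
Origin: expansion seat `planner-pub-hodgecm-mc-theta-3-g13-0`, handover (K7) 2026-08-20T09:09:49Z md5 d81a61e4d78809a2ab487f91622288d0 (572 l.; NEW additive drop-alone leaf over RUN-44 (BT) `ArchSlotBoxTorus`; archimedean transport datum (k, ρ, hk) + relabelled tables (n₂, n₃, hχρ) for #1217's socket; cert rc 0/0 warn/0 proof holes; axioms 66/66 ⊆ trio) (`HOME/mc/pub-hodgecm-mc-theta-3-g13/lean/stage46/HodgeCM/Model/ArchConjTorusTransport.lean`, md5 d81a61e4d788, 572 lines);
landed by the second packager p2 gen 5 (p2-g5) in gate run 46 as `HodgeCM/Model/ArchConjTorusTransport.lean` (verbatim).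
-/
/-
Origin: speedrun cell pub-hodgecm, MODEL-CONSTRUCTION sub-cell, lineage mc-theta-3 (theta supply / second-lift lane, BINDER-OWNERS row 5 `S` slot),
seat planner-pub-hodgecm-mc-theta-3-g13-0 (gen 13), 2026-08-20.  Target in PKG: `HodgeCM/Model/ArchConjTorusTransport.lean`
(NEW additive drop-alone leaf; imports this seat's RUN-44 (BT) `Model/ArchSlotBoxTorus` only; supplies the inputs (k, ρ, hk, n₂, n₃, hχρ) of sinst-1's RUN-46 #1217).
KERNEL only: 0 records / `def … : Prop` / cites, 0 proof holes; intended closure {propext, Classical.choice, Quot.sound}.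
-/
import Summits.HodgeConjecture.HodgeCM.Model.ArchSlotBoxTorus

/-!
# (K7) THE ARCHIMEDEAN TRANSPORT DATUM `(k, ρ)` OF THE CONJUGATED PLANE TORUS

Step (7) of the `hΔ₂`/`hΔ₃` plan (theta-3-g13 memo `J-MU-SLOTS23.g13.md` §5), in the exact currency of sinst-1's
RUN-46 socket `slotTypeVec_sub_eq_of_conj_transport` (#1217 `Model/ArchLineSlotTypeConjArch`): for a see-saw datum
`S` (letters `dW S = (a₀,a₁)`, `dW' S = (a₂,a₃)`, rational isometry `g₀ = S.isoGL : diag(a₂,a₃) ⥲ diag(a₀,a₁)`,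
`isoGL_hg₀`), we construct

* `conjSwapAt S w` — the place-`w` RELABELLING BIT: do the first letters `a₀`, `a₂` have opposite signs through `w`?
  (§1 proves from `isoGL_hg₀` alone that then `sign_w a₀ = sign_w a₃`, `sign_w a₁ = sign_w a₂`, else
  `sign_w a₀ = sign_w a₂`, `sign_w a₁ = sign_w a₃` — Sylvester at each place, 2 × 2);
* `conjTorusRelabel S : T_∞ → T_∞` — the archimedean torus map swapping the two coordinates at the places where
  `conjSwapAt S w` holds (through the vendored `relNormOneInfUnitsEquivCircles : U(1)(L⁺ ⊗ ℝ) ≅ ∏_w U(1)`), with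
  the WEIGHT RELABELLING `archWeight m₀ (fst (ρ t)) * archWeight m₁ (snd (ρ t)) = archWeight n₀ t₀ * archWeight n₁ t₁`,
  `n₀ w = if conjSwapAt S w then m₁ w else m₀ w`, `n₁ w = if conjSwapAt S w then m₀ w else m₁ w`;
* `conjTransportK S : U(diag(a₀,a₁))(L⁺ ⊗ ℝ)` — `k = g₀,∞ · P_σ · Λ` (`P_σ` the place-wise permutation matrix of the
  bit, `Λ` the positive diagonal rescaling `√(a_j / a^σ_j)`), and the TRANSPORT IDENTITY
  `archConjDiag g₀ u = k · archDiag (conjTorusRelabel S u) · k⁻¹` in `U(diag(a₀,a₁))(L⁺ ⊗ ℝ)` (= #1217's `hk`).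

So #1217's inputs `(k, ρ, hk, n₂, n₃, hχρ)` are supplied here; what remains for `hΔ₂`/`hΔ₃` is (STRIP) and (VT) of the memo.
KERNEL only: nothing cited, nothing about PerL/QW8 asserted.
-/

set_option autoImplicit false

noncomputable section

open scoped Matrix Classical ComplexConjugate
open NumberField (InfinitePlace maximalRealSubfield IsCMField)
open NumberField.mixedEmbedding (mixedSpace)
open Literature.NumberTheory.Automorphic Literature.NumberTheory.Automorphic.UnitaryGroup Literature.NumberTheory.Weil1964
open Literature.NumberTheory.GelbartRogawski1991 Literature.NumberTheory.GelbartRogawski1991.UnitaryDualPair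
open HodgeCM.Adelic HodgeCM.PerL34 HodgeCM.Model.HypCensus

namespace HodgeCM.Model.ArchSideTerm

/-! ## §0 two elementary helpers -/

/-- for non-zero reals, `0 < a * b ↔ (0 < a ↔ 0 < b)`. -/
theorem mul_pos_iff_iff_of_ne_zero {a b : ℝ} (ha : a ≠ 0) (hb : b ≠ 0) : 0 < a * b ↔ (0 < a ↔ 0 < b) := by
  rw [mul_pos_iff]
  rcases ha.lt_or_gt with ha' | ha' <;> rcases hb.lt_or_gt with hb' | hb'
  · exact ⟨fun _ => ⟨fun h => absurd ha' (not_lt.2 h.le), fun h => absurd hb' (not_lt.2 h.le)⟩, fun _ => Or.inr ⟨ha', hb'⟩⟩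
  · constructor
    · rintro (⟨h, -⟩ | ⟨-, h⟩)
      · exact absurd ha' (not_lt.2 h.le)
      · exact absurd hb' (not_lt.2 h.le)
    · intro h; exact absurd (h.2 hb') (not_lt.2 ha'.le)
  · constructor
    · rintro (⟨-, h⟩ | ⟨h, -⟩)
      · exact absurd hb' (not_lt.2 h.le)
      · exact absurd ha' (not_lt.2 h.le)
    · intro h; exact absurd (h.1 ha') (not_lt.2 hb'.le)
  · exact ⟨fun _ => ⟨fun _ => hb', fun _ => ha'⟩, fun _ => Or.inl ⟨ha', hb'⟩⟩

/-- a CM field has no real places: matrices over `L ⊗ ℝ` are compared through the complex coordinates `evalC`. -/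
theorem matrix_mixedSpace_eq_of_evalC {L : Type} [Field L] [NumberField L] [IsCMField L] {m n : Type}
    (X Y : Matrix m n (mixedSpace L))
    (h : ∀ w : {w : InfinitePlace L // w.IsComplex}, X.map (evalC L w) = Y.map (evalC L w)) : X = Y := by
  refine Matrix.ext fun i j => Prod.ext ?_ ?_
  · funext v
    exact absurd v.2 (NumberField.InfinitePlace.not_isReal_iff_isComplex.2 (NumberField.IsTotallyComplex.isComplex v.1))
  · funext w
    have hw := congrFun (congrFun (h w) i) j
    simpa only [Matrix.map_apply, evalC_apply] using hw

/-! ## §1 Sylvester at a place: the relabelling bit -/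

section Signs

variable {L : CMField} (S : StubTree.SeesawDatum L) (w : InfinitePlace (L : Type))

/-- the letters are real through every embedding. -/
theorem embedding_dW_eq_re (j : Fin 2) : w.embedding (dW S j) = (((w.embedding (dW S j)).re : ℝ) : ℂ) := by
  have h := IsCMField.complexEmbedding_complexConj (L : Type) w.embedding (dW S j)
  rw [dW_real S j] at h
  exact (Complex.conj_eq_iff_re.mp h.symm).symm

/-- (Ported verbatim from the HodgeCMPerL package; no docstring in the source.) -/
theorem embedding_dW'_eq_re (j : Fin 2) : w.embedding (dW' S j) = (((w.embedding (dW' S j)).re : ℝ) : ℂ) := by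
  have h := IsCMField.complexEmbedding_complexConj (L : Type) w.embedding (dW' S j)
  rw [dW'_real S j] at h
  exact (Complex.conj_eq_iff_re.mp h.symm).symm

/-- (Ported verbatim from the HodgeCMPerL package; no docstring in the source.) -/
theorem re_embedding_dW_ne_zero (j : Fin 2) : (w.embedding (dW S j)).re ≠ 0 :=
  re_apply_ne_zero_of_complexConj_eq (L : Type) w.embedding (dW_real S j) (dW_ne S j)

/-- (Ported verbatim from the HodgeCMPerL package; no docstring in the source.) -/
theorem re_embedding_dW'_ne_zero (j : Fin 2) : (w.embedding (dW' S j)).re ≠ 0 :=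
  re_apply_ne_zero_of_complexConj_eq (L : Type) w.embedding (dW'_real S j) (dW'_ne S j)

/-- `g₀` through `w`. -/
def isoGLAt : Matrix (Fin 2) (Fin 2) ℂ := ((S.isoGL : GL (Fin 2) (L : Type)) : Matrix (Fin 2) (Fin 2) (L : Type)).map w.embedding

/-- **the Gram identity through `w`**: `g₀(w)ᴴ · diag(w(a₀), w(a₁)) · g₀(w) = diag(w(a₂), w(a₃))`. -/
theorem isoGLAt_gram :
    (isoGLAt S w)ᴴ * Matrix.diagonal (fun j => w.embedding (dW S j)) * isoGLAt S w =
      Matrix.diagonal (fun j => w.embedding (dW' S j)) := by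
  have h := congrArg (fun M : Matrix (Fin 2) (Fin 2) (L : Type) => M.map (w.embedding : (L : Type) →+* ℂ)) (isoGL_hg₀ S)
  rw [Matrix.map_mul, Matrix.map_mul, Matrix.diagonal_map (map_zero _), Matrix.diagonal_map (map_zero _),
    ← Matrix.transpose_map, Matrix.map_map] at h
  have hc : (⇑(w.embedding : (L : Type) →+* ℂ) ∘ ⇑(IsCMField.complexConj (L : Type) : (L : Type) →+* (L : Type))) =
      (star ∘ ⇑(w.embedding : (L : Type) →+* ℂ)) := by
    funext x
    exact IsCMField.complexEmbedding_complexConj (L : Type) w.embedding x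
  rw [hc, ← Matrix.map_map, Matrix.transpose_map] at h
  exact h

/-- `det g₀(w) ≠ 0`. -/
theorem det_isoGLAt_ne_zero : (isoGLAt S w).det ≠ 0 := by
  rw [isoGLAt, ← RingHom.mapMatrix_apply, ← RingHom.map_det]
  exact (map_ne_zero _).2 (Matrix.isUnit_iff_isUnit_det _ |>.1 (S.isoGL.isUnit)).ne_zero

/-- (F-det) `a₂ a₃ = |det g₀(w)|² · a₀ a₁` through `w`. -/
theorem re_dW'_mul_re_dW' :
    (w.embedding (dW' S 0)).re * (w.embedding (dW' S 1)).re =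
      Complex.normSq (isoGLAt S w).det * ((w.embedding (dW S 0)).re * (w.embedding (dW S 1)).re) := by
  have h := congrArg Matrix.det (isoGLAt_gram S w)
  rw [Matrix.det_mul, Matrix.det_mul, Matrix.det_conjTranspose, Matrix.det_diagonal, Matrix.det_diagonal,
    Fin.prod_univ_two, Fin.prod_univ_two, embedding_dW_eq_re S w 0, embedding_dW_eq_re S w 1, embedding_dW'_eq_re S w 0,
    embedding_dW'_eq_re S w 1] at h
  simp only [RCLike.star_def] at h
  have h' : (((w.embedding (dW' S 0)).re * (w.embedding (dW' S 1)).re : ℝ) : ℂ) =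
      ((Complex.normSq (isoGLAt S w).det * ((w.embedding (dW S 0)).re * (w.embedding (dW S 1)).re) : ℝ) : ℂ) := by
    rw [Complex.ofReal_mul, ← h, Complex.ofReal_mul, Complex.ofReal_mul, Complex.normSq_eq_conj_mul_self]
    ring
  exact_mod_cast h'

/-- (F-same) `a₂ = a₀ |g₀(w)₀₀|² + a₁ |g₀(w)₁₀|²` through `w`. -/
theorem re_dW'_zero_eq :
    (w.embedding (dW' S 0)).re =
      (w.embedding (dW S 0)).re * Complex.normSq (isoGLAt S w 0 0) + (w.embedding (dW S 1)).re * Complex.normSq (isoGLAt S w 1 0) := by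
  have h := congrFun (congrFun (isoGLAt_gram S w) 0) 0
  rw [Matrix.diagonal_apply_eq, Matrix.mul_apply, Fin.sum_univ_two, Matrix.mul_diagonal, Matrix.mul_diagonal,
    Matrix.conjTranspose_apply, Matrix.conjTranspose_apply, embedding_dW_eq_re S w 0, embedding_dW_eq_re S w 1,
    embedding_dW'_eq_re S w 0] at h
  simp only [RCLike.star_def] at h
  have h' : (((w.embedding (dW' S 0)).re : ℝ) : ℂ) =
      (((w.embedding (dW S 0)).re * Complex.normSq (isoGLAt S w 0 0) + (w.embedding (dW S 1)).re * Complex.normSq (isoGLAt S w 1 0) : ℝ) : ℂ) := by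
    rw [← h, Complex.ofReal_add, Complex.ofReal_mul, Complex.ofReal_mul, Complex.normSq_eq_conj_mul_self,
      Complex.normSq_eq_conj_mul_self]
    ring
  exact_mod_cast h'

/-- the first column of `g₀(w)` is non-zero. -/
theorem normSq_isoGLAt_col_zero_pos : 0 < Complex.normSq (isoGLAt S w 0 0) + Complex.normSq (isoGLAt S w 1 0) := by
  by_contra h
  have h0 : Complex.normSq (isoGLAt S w 0 0) = 0 := by
    have := Complex.normSq_nonneg (isoGLAt S w 0 0); have := Complex.normSq_nonneg (isoGLAt S w 1 0); linarith
  have h1 : Complex.normSq (isoGLAt S w 1 0) = 0 := by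
    have := Complex.normSq_nonneg (isoGLAt S w 0 0); have := Complex.normSq_nonneg (isoGLAt S w 1 0); linarith
  rw [Complex.normSq_eq_zero] at h0 h1
  apply det_isoGLAt_ne_zero S w
  rw [Matrix.det_fin_two, h0, h1, zero_mul, mul_zero, sub_zero]

/-- (S2⁺) both letters of `W` positive through `w` ⇒ `a₂` positive through `w`. -/
theorem re_dW'_zero_pos (h0 : 0 < (w.embedding (dW S 0)).re) (h1 : 0 < (w.embedding (dW S 1)).re) :
    0 < (w.embedding (dW' S 0)).re := by
  rw [re_dW'_zero_eq S w]
  have hc := normSq_isoGLAt_col_zero_pos S w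
  have n0 := Complex.normSq_nonneg (isoGLAt S w 0 0)
  have n1 := Complex.normSq_nonneg (isoGLAt S w 1 0)
  nlinarith [mul_nonneg h0.le n0, mul_nonneg h1.le n1, mul_pos (lt_min h0 h1) hc, min_le_left ((w.embedding (dW S 0)).re) ((w.embedding (dW S 1)).re),
    min_le_right ((w.embedding (dW S 0)).re) ((w.embedding (dW S 1)).re)]

/-- (S2⁻) both letters of `W` negative through `w` ⇒ `a₂` negative through `w`. -/
theorem re_dW'_zero_neg (h0 : (w.embedding (dW S 0)).re < 0) (h1 : (w.embedding (dW S 1)).re < 0) :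
    (w.embedding (dW' S 0)).re < 0 := by
  rw [re_dW'_zero_eq S w]
  have hc := normSq_isoGLAt_col_zero_pos S w
  have n0 := Complex.normSq_nonneg (isoGLAt S w 0 0)
  have n1 := Complex.normSq_nonneg (isoGLAt S w 1 0)
  nlinarith [mul_nonneg (neg_nonneg.2 h0.le) n0, mul_nonneg (neg_nonneg.2 h1.le) n1,
    mul_pos (lt_min (neg_pos.2 h0) (neg_pos.2 h1)) hc, min_le_left (-(w.embedding (dW S 0)).re) (-(w.embedding (dW S 1)).re),
    min_le_right (-(w.embedding (dW S 0)).re) (-(w.embedding (dW S 1)).re)]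

/-- (S1) the sign of `a₀ a₁` through `w` is the sign of `a₂ a₃` through `w`. -/
theorem re_dW_sign_iff :
    ((0 < (w.embedding (dW S 0)).re ↔ 0 < (w.embedding (dW S 1)).re) ↔
      (0 < (w.embedding (dW' S 0)).re ↔ 0 < (w.embedding (dW' S 1)).re)) := by
  rw [← mul_pos_iff_iff_of_ne_zero (re_embedding_dW_ne_zero S w 0) (re_embedding_dW_ne_zero S w 1),
    ← mul_pos_iff_iff_of_ne_zero (re_embedding_dW'_ne_zero S w 0) (re_embedding_dW'_ne_zero S w 1), re_dW'_mul_re_dW' S w]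
  have hd : 0 < Complex.normSq (isoGLAt S w).det := Complex.normSq_pos.2 (det_isoGLAt_ne_zero S w)
  constructor
  · intro h; exact mul_pos hd h
  · intro h; exact pos_of_mul_pos_right h hd.le

/-- **the relabelling bit at `w`**: the first letters `a₀`, `a₂` of the two planes have opposite signs through `w`. -/
def conjSwapAt : Prop := ¬ ((0 < (w.embedding (dW S 0)).re) ↔ (0 < (w.embedding (dW' S 0)).re))

/-- **SIGN MATCHING (no swap)**: `sign_w a₀ = sign_w a₂` and `sign_w a₁ = sign_w a₃`. -/
theorem sign_match_of_not_conjSwapAt (h : ¬ conjSwapAt S w) :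
    ((0 < (w.embedding (dW S 0)).re ↔ 0 < (w.embedding (dW' S 0)).re)) ∧
      ((0 < (w.embedding (dW S 1)).re ↔ 0 < (w.embedding (dW' S 1)).re)) := by
  have h1 := re_dW_sign_iff S w
  unfold conjSwapAt at h
  push Not at h
  tauto

/-- **SIGN MATCHING (swap)**: `sign_w a₀ = sign_w a₃` and `sign_w a₁ = sign_w a₂`. -/
theorem sign_match_of_conjSwapAt (h : conjSwapAt S w) :
    ((0 < (w.embedding (dW S 0)).re ↔ 0 < (w.embedding (dW' S 1)).re)) ∧
      ((0 < (w.embedding (dW S 1)).re ↔ 0 < (w.embedding (dW' S 0)).re)) := by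
  have h1 := re_dW_sign_iff S w
  have h2 : (0 < (w.embedding (dW S 0)).re) → (0 < (w.embedding (dW S 1)).re) → (0 < (w.embedding (dW' S 0)).re) :=
    re_dW'_zero_pos S w
  have h3 : ¬ (0 < (w.embedding (dW S 0)).re) → ¬ (0 < (w.embedding (dW S 1)).re) → ¬ (0 < (w.embedding (dW' S 0)).re) :=
    fun ha hb => not_lt.2 (re_dW'_zero_neg S w ((not_lt.1 ha).lt_of_ne (re_embedding_dW_ne_zero S w 0))
      ((not_lt.1 hb).lt_of_ne (re_embedding_dW_ne_zero S w 1))).le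
  unfold conjSwapAt at h
  tauto

end Signs

/-! ## §2 the torus relabelling `ρ` and the weight relabelling -/

section Relabel

variable {L : CMField} (S : StubTree.SeesawDatum L)

/-- the bit as a permutation of the two letters at `w`. -/
def bitPerm (w : InfinitePlace (L : Type)) (j : Fin 2) : Fin 2 := if conjSwapAt S w then Equiv.swap 0 1 j else j

/-- (Ported verbatim from the HodgeCMPerL package; no docstring in the source.) -/
@[simp] theorem bitPerm_zero_of (w : InfinitePlace (L : Type)) (h : conjSwapAt S w) : bitPerm S w 0 = 1 := by
  simp [bitPerm, h]

/-- (Ported verbatim from the HodgeCMPerL package; no docstring in the source.) -/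
@[simp] theorem bitPerm_one_of (w : InfinitePlace (L : Type)) (h : conjSwapAt S w) : bitPerm S w 1 = 0 := by
  simp [bitPerm, h, Equiv.swap_apply_right]

/-- (Ported verbatim from the HodgeCMPerL package; no docstring in the source.) -/
@[simp] theorem bitPerm_of_not (w : InfinitePlace (L : Type)) (h : ¬ conjSwapAt S w) (j : Fin 2) : bitPerm S w j = j := by
  simp [bitPerm, h]

/-- **SIGN MATCHING** in permutation form: `sign_w a_j = sign_w a'_{σ_w j}`. -/
theorem sign_match (w : InfinitePlace (L : Type)) :
    ∀ j : Fin 2, (0 < (w.embedding (dW S j)).re ↔ 0 < (w.embedding (dW' S (bitPerm S w j))).re) := by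
  rw [Fin.forall_fin_two]
  by_cases h : conjSwapAt S w
  · rw [bitPerm_zero_of S w h, bitPerm_one_of S w h]
    exact sign_match_of_conjSwapAt S w h
  · rw [bitPerm_of_not S w h, bitPerm_of_not S w h]
    exact sign_match_of_not_conjSwapAt S w h

/-- place-wise mixing of two archimedean norm-one units on the bit: `(mixAt t₀ t₁)_w = t₁,w` where `conjSwapAt S w`,
else `t₀,w` (through `U(1)(L⁺ ⊗ ℝ) ≅ ∏_w U(1)`). -/
def mixAt (t₀ t₁ : ↥(relNormOneInfUnits (↥(maximalRealSubfield (L : Type))) (L : Type))) :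
    ↥(relNormOneInfUnits (↥(maximalRealSubfield (L : Type))) (L : Type)) :=
  (relNormOneInfUnitsEquivCircles (L : Type)).symm
    (fun w => if conjSwapAt S w then relNormOneInfUnitsEquivCircles (L : Type) t₁ w else relNormOneInfUnitsEquivCircles (L : Type) t₀ w)

/-- (Ported verbatim from the HodgeCMPerL package; no docstring in the source.) -/
theorem archPlaceChar_mixAt (t₀ t₁ : ↥(relNormOneInfUnits (↥(maximalRealSubfield (L : Type))) (L : Type))) (w : InfinitePlace (L : Type)) :
    archPlaceChar (L : Type) w (mixAt S t₀ t₁) = if conjSwapAt S w then archPlaceChar (L : Type) w t₁ else archPlaceChar (L : Type) w t₀ := by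
  have h := congrFun (archPlaceChars_relNormOneInfUnitsEquivCircles_symm (L : Type)
    (fun w => if conjSwapAt S w then relNormOneInfUnitsEquivCircles (L : Type) t₁ w else relNormOneInfUnitsEquivCircles (L : Type) t₀ w)) w
  rw [archPlaceChars_apply] at h
  rw [mixAt, h]
  split_ifs <;> rfl

/-- (Ported verbatim from the HodgeCMPerL package; no docstring in the source.) -/
theorem coe_archPlaceChar_mixAt (t₀ t₁ : ↥(relNormOneInfUnits (↥(maximalRealSubfield (L : Type))) (L : Type))) (w : InfinitePlace (L : Type)) :
    ((archPlaceChar (L : Type) w (mixAt S t₀ t₁) : Circle) : ℂ) =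
      if conjSwapAt S w then ((archPlaceChar (L : Type) w t₁ : Circle) : ℂ) else ((archPlaceChar (L : Type) w t₀ : Circle) : ℂ) := by
  rw [archPlaceChar_mixAt]
  split_ifs <;> rfl

/-- **the torus relabelling `ρ`**: swap the two coordinates of `T_∞ = U(1)(L⁺ ⊗ ℝ)²` at the places where the bit is set. -/
def conjTorusRelabel (u : NumberField.SeesawArchTorus (L : Type)) : NumberField.SeesawArchTorus (L : Type) :=
  NumberField.SeesawArchTorus.mk (L : Type)
    (mixAt S (NumberField.SeesawArchTorus.fst (L : Type) u) (NumberField.SeesawArchTorus.snd (L : Type) u))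
    (mixAt S (NumberField.SeesawArchTorus.snd (L : Type) u) (NumberField.SeesawArchTorus.fst (L : Type) u))

/-- (Ported verbatim from the HodgeCMPerL package; no docstring in the source.) -/
theorem conjTorusRelabel_mk (t₀ t₁ : ↥(relNormOneInfUnits (↥(maximalRealSubfield (L : Type))) (L : Type))) :
    conjTorusRelabel S (NumberField.SeesawArchTorus.mk (L : Type) t₀ t₁) =
      NumberField.SeesawArchTorus.mk (L : Type) (mixAt S t₀ t₁) (mixAt S t₁ t₀) := rfl

/-- (Ported verbatim from the HodgeCMPerL package; no docstring in the source.) -/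
@[simp] theorem fst_conjTorusRelabel (u : NumberField.SeesawArchTorus (L : Type)) :
    NumberField.SeesawArchTorus.fst (L : Type) (conjTorusRelabel S u) =
      mixAt S (NumberField.SeesawArchTorus.fst (L : Type) u) (NumberField.SeesawArchTorus.snd (L : Type) u) := rfl

/-- (Ported verbatim from the HodgeCMPerL package; no docstring in the source.) -/
@[simp] theorem snd_conjTorusRelabel (u : NumberField.SeesawArchTorus (L : Type)) :
    NumberField.SeesawArchTorus.snd (L : Type) (conjTorusRelabel S u) =
      mixAt S (NumberField.SeesawArchTorus.snd (L : Type) u) (NumberField.SeesawArchTorus.fst (L : Type) u) := rfl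

/-- the relabelled FIRST table: `n₀ w = m₁ w` where the bit is set, else `m₀ w`. -/
def relabel₀ (m₀ m₁ : InfinitePlace (L : Type) → ℤ) (w : InfinitePlace (L : Type)) : ℤ := if conjSwapAt S w then m₁ w else m₀ w

/-- the relabelled SECOND table: `n₁ w = m₀ w` where the bit is set, else `m₁ w`. -/
def relabel₁ (m₀ m₁ : InfinitePlace (L : Type) → ℤ) (w : InfinitePlace (L : Type)) : ℤ := if conjSwapAt S w then m₀ w else m₁ w

/-- **WEIGHT RELABELLING**: `χ_{m₀}((ρt)₀) · χ_{m₁}((ρt)₁) = χ_{n₀}(t₀) · χ_{n₁}(t₁)`. -/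
theorem archWeight_mixAt_mul (m₀ m₁ : InfinitePlace (L : Type) → ℤ)
    (t₀ t₁ : ↥(relNormOneInfUnits (↥(maximalRealSubfield (L : Type))) (L : Type))) :
    archWeight (L : Type) m₀ (mixAt S t₀ t₁) * archWeight (L : Type) m₁ (mixAt S t₁ t₀) =
      archWeight (L : Type) (relabel₀ S m₀ m₁) t₀ * archWeight (L : Type) (relabel₁ S m₀ m₁) t₁ := by
  rw [archWeight_eq_prod, archWeight_eq_prod, archWeight_eq_prod, archWeight_eq_prod, ← Finset.prod_mul_distrib,
    ← Finset.prod_mul_distrib]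
  refine Finset.prod_congr rfl fun w _ => ?_
  rw [coe_archPlaceChar_mixAt, coe_archPlaceChar_mixAt]
  unfold relabel₀ relabel₁
  split_ifs <;> ring

/-- the same for a character of `T_∞` given by two tables (the shape of #1217's `hχ` / `hχρ`). -/
theorem archWeight_conjTorusRelabel (m₀ m₁ : InfinitePlace (L : Type) → ℤ)
    (t₀ t₁ : ↥(relNormOneInfUnits (↥(maximalRealSubfield (L : Type))) (L : Type))) :
    archWeight (L : Type) m₀ (NumberField.SeesawArchTorus.fst (L : Type) (conjTorusRelabel S (NumberField.SeesawArchTorus.mk (L : Type) t₀ t₁))) *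
        archWeight (L : Type) m₁ (NumberField.SeesawArchTorus.snd (L : Type) (conjTorusRelabel S (NumberField.SeesawArchTorus.mk (L : Type) t₀ t₁))) =
      archWeight (L : Type) (relabel₀ S m₀ m₁) t₀ * archWeight (L : Type) (relabel₁ S m₀ m₁) t₁ :=
  archWeight_mixAt_mul S m₀ m₁ t₀ t₁

end Relabel

/-! ## §3 the transport element `k = g₀,∞ · P_σ · Λ ∈ U(diag(a₀,a₁))(L⁺ ⊗ ℝ)` and the transport identity -/

section Transport

variable {L : CMField} (S : StubTree.SeesawDatum L)

/-- the positive rescaling `λ_j(w) = √(a_j(w) / a'_{σ_w j}(w))`. -/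
def transportScale (w : InfinitePlace (L : Type)) (j : Fin 2) : ℝ :=
  Real.sqrt ((w.embedding (dW S j)).re / (w.embedding (dW' S (bitPerm S w j))).re)

/-- (Ported verbatim from the HodgeCMPerL package; no docstring in the source.) -/
theorem transportScale_ratio_pos (w : InfinitePlace (L : Type)) (j : Fin 2) :
    0 < (w.embedding (dW S j)).re / (w.embedding (dW' S (bitPerm S w j))).re := by
  have hm := sign_match S w j
  rcases (re_embedding_dW_ne_zero S w j).lt_or_gt with h | h
  · have h' : (w.embedding (dW' S (bitPerm S w j))).re < 0 :=
      (not_lt.1 fun h'' => (not_lt.2 h.le) (hm.2 h'')).lt_of_ne (re_embedding_dW'_ne_zero S w _)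
    exact div_pos_of_neg_of_neg h h'
  · exact div_pos h (hm.1 h)

/-- (Ported verbatim from the HodgeCMPerL package; no docstring in the source.) -/
theorem transportScale_pos (w : InfinitePlace (L : Type)) (j : Fin 2) : 0 < transportScale S w j :=
  Real.sqrt_pos.2 (transportScale_ratio_pos S w j)

/-- (Ported verbatim from the HodgeCMPerL package; no docstring in the source.) -/
theorem transportScale_ne_zero (w : InfinitePlace (L : Type)) (j : Fin 2) : (transportScale S w j : ℂ) ≠ 0 :=
  Complex.ofReal_ne_zero.2 (transportScale_pos S w j).ne'

/-- `λ_j(w)² · a'_{σ_w j}(w) = a_j(w)`. -/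
theorem transportScale_sq_mul (w : InfinitePlace (L : Type)) (j : Fin 2) :
    transportScale S w j * transportScale S w j * (w.embedding (dW' S (bitPerm S w j))).re = (w.embedding (dW S j)).re := by
  rw [transportScale, Real.mul_self_sqrt (transportScale_ratio_pos S w j).le,
    div_mul_cancel₀ _ (re_embedding_dW'_ne_zero S w _)]

/-- `P_σ · Λ` through `w`. -/
def transportMatAt (w : InfinitePlace (L : Type)) : Matrix (Fin 2) (Fin 2) ℂ :=
  if conjSwapAt S w then !![0, (transportScale S w 1 : ℂ); (transportScale S w 0 : ℂ), 0]
  else !![(transportScale S w 0 : ℂ), 0; 0, (transportScale S w 1 : ℂ)]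

/-- its inverse through `w`. -/
def transportInvAt (w : InfinitePlace (L : Type)) : Matrix (Fin 2) (Fin 2) ℂ :=
  if conjSwapAt S w then !![0, ((transportScale S w 0 : ℂ))⁻¹; ((transportScale S w 1 : ℂ))⁻¹, 0]
  else !![((transportScale S w 0 : ℂ))⁻¹, 0; 0, ((transportScale S w 1 : ℂ))⁻¹]

/-- (Ported verbatim from the HodgeCMPerL package; no docstring in the source.) -/
theorem transportMatAt_mul_inv (w : InfinitePlace (L : Type)) : transportMatAt S w * transportInvAt S w = 1 := by
  have h0 := transportScale_ne_zero S w 0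
  have h1 := transportScale_ne_zero S w 1
  unfold transportMatAt transportInvAt
  split_ifs <;>
  · ext i j
    fin_cases i <;> fin_cases j <;> simp [Matrix.mul_apply, Fin.sum_univ_two, h0, h1]

/-- (Ported verbatim from the HodgeCMPerL package; no docstring in the source.) -/
theorem transportInvAt_mul (w : InfinitePlace (L : Type)) : transportInvAt S w * transportMatAt S w = 1 := by
  have h0 := transportScale_ne_zero S w 0
  have h1 := transportScale_ne_zero S w 1
  unfold transportMatAt transportInvAt
  split_ifs <;>
  · ext i j
    fin_cases i <;> fin_cases j <;> simp [Matrix.mul_apply, Fin.sum_univ_two, h0, h1]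


-- port_pkg: scope closed for this part
end Transport
end HodgeCM.Model.ArchSideTerm
end
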